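import Summits.Ventures.QEC.Census.CertCoverBatch
import Summits.Ventures.QEC.Census.BB.A1s_n168_k6_98626cb8.CoreDefs
import HarnessLib

set_option Elab.async false
set_option maxRecDepth 200000

/-!
# `[[168,6,16]]` one-level cover certificate of `A1s_n168_k6_98626cb8` — LEVEL-1→0 coset problems 381…398 (deep problems [5] excluded: `ProbDeep*.lean`) as COMPACT data
(`ProbData`: U, f, σ, y₀, allow; qec-type-10 `CertCoverBatch.mkCoset` rebuilds each `CosetProb` in the kernel) + their verdict
`probsOK cov covR hx hx1 D1 lxd 14` (one `decide +kernel`; 18 problems, depths f=0:16 f=1:2 f=2:0 f=3:0, est. 72.0 s).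
qec-search-1 g5 (pattern of search-9 g5 `Probs*`); data from JSON `level10.problems` (sha256 2704e96faadf7ca5…). Data + decided check; KERNEL.
-/

namespace Summit.Ventures.QEC.Census.A1s_n168_k6_98626cb8

open Matrix Summit.Ventures.QEC.Census Literature.InformationTheory.QuantumCodes

/-- Problems 381…398 (18): `⟨U, f, σ, y₀, allow⟩`. -/
def probs09 : List ProbData := [
    ⟨77965454666504129740848, 0, 1650376863789, 75604268887166809026620, []⟩,
    ⟨77966029719330720202800, 0, 1100621041673, 77929136231204836749372, []⟩,
    ⟨77966606462107756134416, 0, 1100621049917, 36893488168954769452, []⟩,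
    ⟨77967183766736307503120, 0, 1650376855577, 77957383933965463715864, []⟩,
    ⟨78298071112681116532736, 0, 2199063113737, 2666420340107507793920, []⟩,
    ⟨78302685046101308866816, 0, 1113796777, 78228895747642211992048, []⟩,
    ⟨80586925486361594037314, 0, 2199097181506, 80577702114450294750258, []⟩,
    ⟨80603086664603420066304, 1, 550903218723, 18446898005337510364, []⟩,
    ⟨80604220437029623824417, 0, 1148191538, 80604202281906517198854, []⟩,
    ⟨80604238460207046459936, 0, 1147404851, 75557863875447904825380, []⟩,
    ⟨80607696094423989486336, 0, 2748852929155, 18446893607293227228, []⟩,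
    ⟨80884397387779997188224, 0, 2611417711237, 76152807251402022797408, []⟩,
    ⟨81474802304566507347993, 0, 2199110367894, 5912326892672522391552, []⟩,
    ⟨81474982413504702586896, 0, 2216289186459, 5912470972813631553536, []⟩,
    ⟨81475666855232352026633, 0, 2199110363788, 75562475411971520860169, []⟩,
    ⟨117040576223941115383808, 0, 1661018544, 3699150899494149845028, []⟩,
    ⟨152305615069594211352834, 1, 274899009546, 151115800085910781989390, []⟩,
    ⟨231572373936251418574849, 0, 1146110770, 75577481546641528858655, []⟩]

set_option maxHeartbeats 400000000 in
/-- Every problem of this chunk passes (`mkCoset` elimination + `cosetOKD` + fast `σ` + depth + `BU`-evenness + label checks). -/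
theorem probs09_ok : probsOK A1s_n168_k6_98626cb8.cov covR hx hx1 D1 lxd 14 probs09 = true := by
  decide +kernel

/-- Pointwise form. -/
theorem probs09_all : ∀ x ∈ A1s_n168_k6_98626cb8.probs09, probOK cov covR hx hx1 D1 lxd 14 x = true := by
  have h := probs09_ok
  rwa [probsOK, List.all_eq_true] at h

end Summit.Ventures.QEC.Census.A1s_n168_k6_98626cb8
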